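import Summits.BirchSwinnertonDyer.BirchSwinnertonDyer.Theorems.ManinLocalTwoThreeThreeShiftGlue
import HarnessLib

/-!
# The cube step, I: `SL(2, ℤ)` acting on `P¹(𝔽₃)` and the transfer from a point stabiliser
# (route `ManinLocalTwoThree`, cell bsd-f2-manin; crux C3 `ManinPrimeToThreeAtNine` stmt-BirchSwinnertonDyer-22968; prover seat p3
# gen 10; toolkit for es's cube-step nodes E-es-103 `CubeStepDescent` / E-es-104 `CubeStepAntiDescent`)

At a level `M` prime to `3` the two subgroups of the 3-shift step, `B = Γ₀(3M)` and `A = Γ₀(M) ∩ Γ⁰(3)`, are the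
stabilisers in `G = Γ₀(M)` of the points `∞` and `0` of the projective line `P¹(𝔽₃)` (four points), on which `G` acts
through `PSL₂(𝔽₃) ≅ A₄`; they are NOT normal (the «cube» configuration of MEMO-es §37.9 (2)(i)), so the gluing engine of
`…ThreeShiftGlue.lean` does not apply.  The replacement is the TRANSFER from the index-4 stabiliser (`4 ≡ 1 (mod 3)`):
* §1 the abstract transfer: for a group `G` acting on a finite set `X` with a section `r` of the orbit map at `x₀`
  (`act (r x) x₀ = x`), the cocycle `tr g x = r(g·x)⁻¹ g r(x)` stabilises `x₀`, and for `ϕ` additive on the stabiliser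
  `transferSum ϕ g = Σₓ ϕ (tr g x)` is additive on all of `G` (`transferSum_mul`);
* §2 the action of `SL(2, ℤ)` on `P¹(𝔽₃) = Option (ZMod 3)` (`none = ∞ = [1:0]`, `some j = [j:1]`) by reduction mod 3
  (`act`, `act_one`, `act_mul`), the stabiliser criteria `act γ ∞ = ∞ ↔ 3 ∣ c`, `act γ 0 = 0 ↔ 3 ∣ b`, the kernel
  (`b ≡ c ≡ 0`), the translations `act γ [u:1] = [u + bd : 1]` for `3 ∣ c`, and the action of the explicit matrices
  `g0Of` / `Tpow`.
Nothing about BSD, Manin's conjecture or the laws E-es-94♯/96–107 is asserted here.  References: MEMO-es §37.9 (3)–(4)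
(THEOREMS IV, IV⁻); the transfer: e.g. K. S. Brown, *Cohomology of Groups*, III.9.
-/

set_option autoImplicit false
set_option linter.dupNamespace false

open scoped MatrixGroups

open CongruenceSubgroup Matrix.SpecialLinearGroup
  Summit.BirchSwinnertonDyer.Rank1Residual.ManinAdditive.NineShiftEqualiser

namespace Summit.BirchSwinnertonDyer.BirchSwinnertonDyer.Theorems.ManinLocalTwoThree

namespace CubeStep

/-! ### §1. The transfer from a point stabiliser -/

section Transfer

variable {G : Type*} [Group G] {X : Type*} {Z : Type*} [AddCommGroup Z]
  (act : G → X → X) (r : X → G)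

/-- The transfer cocycle `tr g x = r(g·x)⁻¹ · g · r(x)`. [folklore] -/
def tr (g : G) (x : X) : G := (r (act g x))⁻¹ * g * r x

/-- The cocycle identity `tr (gh) x = tr g (h·x) · tr h x`. [folklore] -/
theorem tr_mul (hmul : ∀ g h x, act (g * h) x = act g (act h x)) (g h : G) (x : X) :
    tr act r (g * h) x = tr act r g (act h x) * tr act r h x := by
  unfold tr
  rw [hmul]
  group

/-- The cocycle takes values in the stabiliser of the base point `x₀`. [folklore] -/
theorem act_tr (hmul : ∀ g h x, act (g * h) x = act g (act h x)) (hone : ∀ x, act 1 x = x) {x₀ : X}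
    (hr : ∀ x, act (r x) x₀ = x) (g : G) (x : X) : act (tr act r g x) x₀ = x₀ := by
  have hinv : ∀ y, act (r y)⁻¹ y = x₀ := fun y => by
    have h1 : act ((r y)⁻¹ * r y) x₀ = x₀ := by rw [inv_mul_cancel, hone]
    rwa [hmul, hr] at h1
  unfold tr
  rw [hmul, hmul, hr, hinv]

/-- An action by group elements is by bijections. [folklore] -/
theorem act_bijective (hmul : ∀ g h x, act (g * h) x = act g (act h x)) (hone : ∀ x, act 1 x = x) (g : G) :
    Function.Bijective (act g) := by
  refine Function.bijective_iff_has_inverse.mpr ⟨act g⁻¹, fun x => ?_, fun x => ?_⟩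
  · rw [← hmul, inv_mul_cancel, hone]
  · rw [← hmul, mul_inv_cancel, hone]

variable [Fintype X]

/-- The transfer of `ϕ` (a function additive on the stabiliser of `x₀`): `Σₓ ϕ (tr g x)`. [folklore] -/
def transferSum (ϕ : G → Z) (g : G) : Z := ∑ x, ϕ (tr act r g x)

/-- **The transfer is additive on the whole group.** [folklore; Brown, Cohomology of Groups III.9] -/
theorem transferSum_mul (hmul : ∀ g h x, act (g * h) x = act g (act h x)) (hone : ∀ x, act 1 x = x) {x₀ : X}
    (hr : ∀ x, act (r x) x₀ = x) {ϕ : G → Z}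
    (hϕ : ∀ u v : G, act u x₀ = x₀ → act v x₀ = x₀ → ϕ (u * v) = ϕ u + ϕ v) (g h : G) :
    transferSum act r ϕ (g * h) = transferSum act r ϕ g + transferSum act r ϕ h := by
  unfold transferSum
  have e1 : ∑ x, ϕ (tr act r (g * h) x) = ∑ x, (ϕ (tr act r g (act h x)) + ϕ (tr act r h x)) := by
    refine Finset.sum_congr rfl fun x _ => ?_
    rw [tr_mul act r hmul, hϕ _ _ (act_tr act r hmul hone hr g _) (act_tr act r hmul hone hr h x)]
  rw [e1, Finset.sum_add_distrib]
  congr 1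
  exact Fintype.sum_bijective (act h) (act_bijective act hmul hone h) _ _ fun x => rfl

/-- The transfer at an element acting trivially whose cocycle values have constant `ϕ`-value `z`:
`transferSum ϕ g = |X| • z`. [folklore] -/
theorem transferSum_eq_card_smul {ϕ : G → Z} {g : G} {z : Z} (h : ∀ x, ϕ (tr act r g x) = z) :
    transferSum act r ϕ g = Fintype.card X • z := by
  unfold transferSum
  simp_rw [h]
  rw [Finset.sum_const, Finset.card_univ]

end Transfer

/-! ### §2. `P¹(𝔽₃)` as `Option (ZMod 3)` and the action of `SL(2, ℤ)` -/

section ProjectiveLine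

/-- Homogeneous coordinates of a point of `P¹(𝔽₃)`: `∞ = none ↦ (1, 0)`, `some j ↦ (j, 1)`. [folklore] -/
def vec : Option (ZMod 3) → ZMod 3 × ZMod 3
  | none => (1, 0)
  | some j => (j, 1)

/-- The point of `P¹(𝔽₃)` with homogeneous coordinates `(u, v) ≠ (0, 0)` (recall `v⁻¹ = v` in `𝔽₃ˣ`). [folklore] -/
def label (u v : ZMod 3) : Option (ZMod 3) := if v = 0 then none else some (u * v)

/-- `label ∘ vec = id`. [folklore] -/
theorem label_vec (ℓ : Option (ZMod 3)) : label (vec ℓ).1 (vec ℓ).2 = ℓ := by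
  rcases ℓ with _ | j
  · simp [vec, label]
  · simp [vec, label]

/-- `vec ∘ label` rescales by a unit. [folklore] -/
theorem vec_label (u v : ZMod 3) (h : ¬(u = 0 ∧ v = 0)) :
    ∃ l : ZMod 3, l ≠ 0 ∧ vec (label u v) = (l * u, l * v) := by
  revert u v h
  decide

/-- `label` is invariant under rescaling by a unit. [folklore] -/
theorem label_smul (l u v : ZMod 3) (hl : l ≠ 0) : label (l * u) (l * v) = label u v := by
  revert l u v hl
  decide

/-- A matrix of determinant `1` over `𝔽₃` does not kill a nonzero vector. [folklore] -/
theorem apply_ne_zero (a b c d u v : ZMod 3) (hdet : a * d - b * c = 1) (h : ¬(u = 0 ∧ v = 0)) :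
    ¬(a * u + b * v = 0 ∧ c * u + d * v = 0) := by
  revert a b c d u v hdet h
  decide

/-- `vec ℓ ≠ 0`. [folklore] -/
theorem vec_ne_zero (ℓ : Option (ZMod 3)) : ¬((vec ℓ).1 = 0 ∧ (vec ℓ).2 = 0) := by
  rcases ℓ with _ | j <;> simp [vec]

/-- The mod-3 reduction of an entry of `γ ∈ SL(2, ℤ)`. [folklore] -/
abbrev ent (γ : SL(2, ℤ)) (i j : Fin 2) : ZMod 3 := ((γ i j : ℤ) : ZMod 3)

/-- `ent γ i j = 0 ↔ 3 ∣ γ i j`. [folklore] -/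
theorem ent_eq_zero_iff (γ : SL(2, ℤ)) (i j : Fin 2) : ent γ i j = 0 ↔ (3 : ℤ) ∣ (γ i j : ℤ) := by
  have h := ZMod.intCast_zmod_eq_zero_iff_dvd (γ i j : ℤ) 3
  exact_mod_cast h

/-- The determinant of `γ ∈ SL(2, ℤ)` mod 3. [folklore] -/
theorem det_ent (γ : SL(2, ℤ)) : ent γ 0 0 * ent γ 1 1 - ent γ 0 1 * ent γ 1 0 = 1 := by
  have h := Matrix.det_fin_two (γ : Matrix (Fin 2) (Fin 2) ℤ)
  rw [γ.2] at h
  have h' := congrArg (Int.cast : ℤ → ZMod 3) h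
  push_cast at h'
  simpa [ent] using h'.symm

/-- **The action of `SL(2, ℤ)` on `P¹(𝔽₃)`** (through reduction mod 3, on column vectors). [folklore] -/
def act (γ : SL(2, ℤ)) (ℓ : Option (ZMod 3)) : Option (ZMod 3) :=
  label (ent γ 0 0 * (vec ℓ).1 + ent γ 0 1 * (vec ℓ).2) (ent γ 1 0 * (vec ℓ).1 + ent γ 1 1 * (vec ℓ).2)

/-- `1` acts trivially. [folklore] -/
theorem act_one (ℓ : Option (ZMod 3)) : act 1 ℓ = ℓ := by
  simp [act, ent, label_vec]

/-- **`act` is an action**: `(γδ)·ℓ = γ·(δ·ℓ)`. [folklore] -/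
theorem act_mul (γ δ : SL(2, ℤ)) (ℓ : Option (ZMod 3)) : act (γ * δ) ℓ = act γ (act δ ℓ) := by
  set u := (vec ℓ).1 with hu
  set v := (vec ℓ).2 with hv
  set p := ent δ 0 0 * u + ent δ 0 1 * v with hp
  set q := ent δ 1 0 * u + ent δ 1 1 * v with hq
  have hpq : ¬(p = 0 ∧ q = 0) := apply_ne_zero _ _ _ _ u v (det_ent δ) (vec_ne_zero ℓ)
  obtain ⟨l, hl, hvl⟩ := vec_label p q hpq
  have hR : act γ (act δ ℓ) = label (ent γ 0 0 * p + ent γ 0 1 * q) (ent γ 1 0 * p + ent γ 1 1 * q) := by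
    rw [show act δ ℓ = label p q from rfl, act, hvl]
    dsimp only
    rw [show ent γ 0 0 * (l * p) + ent γ 0 1 * (l * q) = l * (ent γ 0 0 * p + ent γ 0 1 * q) by ring,
      show ent γ 1 0 * (l * p) + ent γ 1 1 * (l * q) = l * (ent γ 1 0 * p + ent γ 1 1 * q) by ring,
      label_smul _ _ _ hl]
  have hent : ∀ i j : Fin 2, ent (γ * δ) i j = ent γ i 0 * ent δ 0 j + ent γ i 1 * ent δ 1 j := by
    intro i j
    simp [ent, Matrix.SpecialLinearGroup.coe_mul, Matrix.mul_apply, Fin.sum_univ_two]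
  rw [hR, act, hent, hent, hent, hent]
  congr 1
  · rw [hp, hq]; ring
  · rw [hp, hq]; ring

/-- `γ⁻¹·(γ·ℓ) = ℓ`. [folklore] -/
theorem act_inv_act (γ : SL(2, ℤ)) (ℓ : Option (ZMod 3)) : act γ⁻¹ (act γ ℓ) = ℓ := by
  rw [← act_mul, inv_mul_cancel, act_one]

/-- `γ·ℓ` is injective in `ℓ`. [folklore] -/
theorem act_injective (γ : SL(2, ℤ)) : Function.Injective (act γ) := fun x y h => by
  simpa [act_inv_act] using congrArg (act γ⁻¹) h

/-- `γ·∞` in coordinates. [folklore] -/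
theorem act_none (γ : SL(2, ℤ)) : act γ none = label (ent γ 0 0) (ent γ 1 0) := by
  simp [act, vec]

/-- `γ·0` in coordinates. [folklore] -/
theorem act_some_zero (γ : SL(2, ℤ)) : act γ (some 0) = label (ent γ 0 1) (ent γ 1 1) := by
  simp [act, vec]

/-- **`B = Stab(∞)`**: `γ·∞ = ∞ ↔ 3 ∣ c`. [folklore] -/
theorem act_none_eq_none_iff (γ : SL(2, ℤ)) : act γ none = none ↔ (3 : ℤ) ∣ (γ 1 0 : ℤ) := by
  rw [act_none, label, ← ent_eq_zero_iff]
  constructor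
  · intro h
    by_contra hc
    rw [if_neg hc] at h
    exact Option.some_ne_none _ h
  · intro h
    simp [ent, h]

/-- Auxiliary: for `ad − bc = 1` in `𝔽₃`, `label b d = 0 ↔ b = 0`. [folklore] -/
theorem label_eq_some_zero_iff (a b c d : ZMod 3) (hdet : a * d - b * c = 1) : label b d = some 0 ↔ b = 0 := by
  revert a b c d hdet
  decide

/-- **`A = Stab(0)`**: `γ·0 = 0 ↔ 3 ∣ b`. [folklore] -/
theorem act_some_zero_eq_iff (γ : SL(2, ℤ)) : act γ (some 0) = some 0 ↔ (3 : ℤ) ∣ (γ 0 1 : ℤ) := by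
  rw [act_some_zero, label_eq_some_zero_iff _ _ _ _ (det_ent γ), ← ent_eq_zero_iff]

/-- Auxiliary: `ad = 1` in `𝔽₃` forces `d = a ≠ 0`. [folklore] -/
theorem eq_of_mul_eq_one (a d : ZMod 3) (h : a * d = 1) : d = a ∧ a ≠ 0 := by
  revert a d h
  decide

/-- **The kernel of the action**: `b ≡ c ≡ 0 (mod 3)` implies `γ` acts trivially (`γ ≡ ±I`). [folklore] -/
theorem act_eq_self (γ : SL(2, ℤ)) (hb : (3 : ℤ) ∣ (γ 0 1 : ℤ)) (hc : (3 : ℤ) ∣ (γ 1 0 : ℤ))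
    (ℓ : Option (ZMod 3)) : act γ ℓ = ℓ := by
  have hb' : ent γ 0 1 = 0 := (ent_eq_zero_iff γ 0 1).mpr hb
  have hc' : ent γ 1 0 = 0 := (ent_eq_zero_iff γ 1 0).mpr hc
  have hdet := det_ent γ
  rw [hb', hc', zero_mul, sub_zero] at hdet
  obtain ⟨hd, ha⟩ := eq_of_mul_eq_one _ _ hdet
  rw [act, hb', hc', hd, zero_mul, add_zero, zero_mul, zero_add, label_smul _ _ _ ha, label_vec]

/-- **Translations**: an element of `Stab(∞)` (`3 ∣ c`) acts on the affine line by `u ↦ u + b·d`. [folklore] -/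
theorem act_some_of_dvd (γ : SL(2, ℤ)) (hc : (3 : ℤ) ∣ (γ 1 0 : ℤ)) (u : ZMod 3) :
    act γ (some u) = some (u + ent γ 0 1 * ent γ 1 1) := by
  have hc' : ent γ 1 0 = 0 := (ent_eq_zero_iff γ 1 0).mpr hc
  have hdet := det_ent γ
  rw [hc', mul_zero, sub_zero] at hdet
  obtain ⟨_, ha⟩ := eq_of_mul_eq_one _ _ hdet
  have hd : ent γ 1 1 ≠ 0 := fun h => by rw [h, mul_zero] at hdet; exact zero_ne_one hdet
  simp only [act, vec, hc', zero_mul, zero_add, mul_one, label, if_neg hd]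
  congr 1
  linear_combination u * hdet

/-- An element fixing `∞` and `0` acts trivially. [folklore] -/
theorem act_eq_self_of_fix (γ : SL(2, ℤ)) (h1 : act γ none = none) (h2 : act γ (some 0) = some 0)
    (ℓ : Option (ZMod 3)) : act γ ℓ = ℓ :=
  act_eq_self γ ((act_some_zero_eq_iff γ).mp h2) ((act_none_eq_none_iff γ).mp h1) ℓ

/-- Every `γ` maps SOME finite point to a finite point. [folklore] -/
theorem exists_act_some_eq_some (γ : SL(2, ℤ)) : ∃ u v : ZMod 3, act γ (some u) = some v := by
  by_cases h : act γ (some 0) = none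
  · have h1 : act γ (some 1) ≠ none := fun h1 => by
      have := act_injective γ (h.trans h1.symm)
      exact absurd (Option.some_injective _ this) (by decide)
    obtain ⟨v, hv⟩ := Option.ne_none_iff_exists'.mp h1
    exact ⟨1, v, hv⟩
  · obtain ⟨v, hv⟩ := Option.ne_none_iff_exists'.mp h
    exact ⟨0, v, hv⟩

variable {M : ℕ}

/-- The action of an explicit matrix `g0Of a b c d ∈ Γ₀(M)`. [folklore] -/
theorem act_g0Of (a b c d : ℤ) (h : a * d - b * c = 1) (hc : (M : ℤ) ∣ c) (ℓ : Option (ZMod 3)) :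
    act ((g0Of a b c d h hc : Gamma0 M) : SL(2, ℤ)) ℓ =
      label ((a : ZMod 3) * (vec ℓ).1 + (b : ZMod 3) * (vec ℓ).2)
        ((c : ZMod 3) * (vec ℓ).1 + (d : ZMod 3) * (vec ℓ).2) := rfl

/-- `T^k` fixes `∞`. [folklore] -/
theorem act_Tpow_none (k : ℤ) : act ((ThreeShiftDescent.Tpow M k : Gamma0 M) : SL(2, ℤ)) none = none := by
  simp [ThreeShiftDescent.Tpow, act_g0Of, vec, label]

/-- `T^k` translates the affine line by `k`. [folklore] -/
theorem act_Tpow_some (k : ℤ) (u : ZMod 3) :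
    act ((ThreeShiftDescent.Tpow M k : Gamma0 M) : SL(2, ℤ)) (some u) = some (u + (k : ZMod 3)) := by
  simp [ThreeShiftDescent.Tpow, act_g0Of, vec, label]

end ProjectiveLine

end CubeStep

end Summit.BirchSwinnertonDyer.BirchSwinnertonDyer.Theorems.ManinLocalTwoThree
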